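import Mathlib
import HarnessLib
import Literature.MathematicalPhysics.QuantumLattice.GaugeGroups
import Summits.Ventures.LatticeQCDFlow.Exactness.SpectralKernelMap

/-!
# The spectral kernel is continuous on `U(n)` / `SU(n)` exactly when its eigenvalue map is continuous on the torus — across all spectral strata, degenerate spectra included

HONEST FRAMING: exact (Metropolis-corrected) sampling algorithms for lattice gauge theory;
figures of merit are autocorrelation/cost numbers at stated couplings and volumes; no
continuum-physics claim.

Venture `LatticeQCDFlow` (cell pub-lqcd), topic `Exactness`; FANOUT row 10 (`eng-equiv`, engine
`latflow.equiv`, module `equiv/spectral.py`: the kernel `W = V diag(λ) V† ↦ V diag(f λ) V†` of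
`spectral_kernel` / `SUNSpectralCoupling`, releases `equiv-0.2.0 … 0.4.1`; the same kernel in
`latflow.flows_jax.spectral_jax`, differentiated THROUGH `eig`).  NEW WORK of the cell over
`SpectralKernelConjugation.lean` / `SpectralKernelMap.lean` (well-definedness and existence of the
kernel, by CHOICE of a diagonalisation at every argument) and the tree's
`Literature/MathematicalPhysics/QuantumLattice/GaugeGroups.lean` (`U(n)`, `SU(n)` compact, Borel);
nothing is cited as a fact; no number; no definition is introduced.  Printed counterpart, NAMED
ONLY: Boyda et al., *Sampling using `SU(N)` gauge equivariant flows*, PRD 103 (2021) 074504,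
§III (kernels), App. A (Prop. 2 and the sentence after Example 1: "any matrix conjugation
equivariant function on T can be extended to an equivariant function on G") and App. C
("Equation (C1) does not fully constrain d and P, so they may further depend on U; such
dependence … is an implementation detail of the diagonalization procedure").

## The question

`SpectralKernelMap.exists_spectralKernel_unitaryGroup` builds the kernel `h` by choosing, at every
`P ∈ U(n)`, SOME unitary diagonalisation `P = V diag(d) V⋆` and returning `V diag(f d) V⋆`;
`spectralKernel_wellDefined` says the value does not depend on the choice.  Nothing so far says
that `h` is continuous: the chosen frames `V` jump wildly (they cannot be chosen continuously
across a degenerate spectrum — the engine's `eig` returns arbitrary frames there), and the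
polynomial form `h P = q_{spec P}(P)` of `SpectralKernelPolynomial.lean` changes polynomial from
stratum to stratum.  For the layer to be a measurable transport map at all (the hypothesis `hψ`
of `KernelCouplingJacobian.hasJacobian_kernelCouplingLayer`), and for the numerics' "smooth
across cell walls" claim to have a typed floor, one wants: `h` is continuous as soon as `f` is
continuous on the unimodular torus.  This file proves it, and the converse.

## Content (`n` any finite index type; `T = {d : n → ℂ | ∀ i, ‖d i‖ = 1}`)

* `isCompact_unimodularTorus`, `isCompact_unitaryFrames` — `T` and `U(n) × T` are compact;
  `continuous_conjDiagonal` — `(V, e) ↦ V diag(e) V⋆` is continuous;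
* **`continuous_of_spectralRecipe`** — THE MECHANISM, parametric and choice-free: on any
  topological space `X`, if `ι : X → U(n)` is continuous, `F : X → (eigenvalue maps)` is jointly
  continuous on `X × T`, and `g x = V diag(F x d) V⋆` whenever `ι x = V diag(d) V⋆`, then `g` is
  continuous.  Proof: for closed `C`, `g⁻¹ C` is the projection along the COMPACT factor
  `U(n) × T` of the closed set `{(x, V, d) | ι x = V diag(d) V⋆, V diag(F x d) V⋆ ∈ C}`, hence
  closed (`isClosedMap_fst_of_compactSpace`) — no frame is ever chosen, so degenerate spectra
  need no separate treatment;
* **`continuous_spectralKernel_unitaryGroup`** / **`…_specialUnitaryGroup`** — every map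
  `h : U(n) → U(n)` (`SU(n) → SU(n)`) agreeing with the spectral recipe of an `f` continuous on
  `T` is continuous; **`continuous_spectralKernel_unitaryGroup_param`** / `…_special…_param` —
  jointly continuous in (conditioner parameters, loop) when `f` is jointly continuous, which is
  the shape of the engine's layer (the spline parameters come from the frozen context);
* the converse **`continuousOn_eigenvalueMap_of_continuous`** (`f d = diag⁻¹(h (diag d))` on
  `T`) and the packaged **`continuous_spectralKernel_unitaryGroup_iff`**;
* corollaries: `measurable_spectralKernel_unitaryGroup` / `…_specialUnitaryGroup` (Borel),
  `uniformContinuous_spectralKernel_unitaryGroup` (compact domain), and the existence form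
  **`exists_continuous_spectralKernel_unitaryGroup`** / `…_specialUnitaryGroup` (file
  `SpectralKernelMap` + this one: a continuous conjugation-equivariant kernel exists for every
  continuous permutation-equivariant admissible `f`).

NOT here: differentiability / the Jacobian of `h` (Haar–Vandermonde factor, Boyda eq. (19));
any number.
-/

namespace Summit.Ventures.LatticeQCDFlow.Exactness

open Matrix Topology
open Literature.LinearAlgebra.Matrix
open Literature.MathematicalPhysics.QuantumLattice (diagonal_mem_unitaryGroup_iff)

section Recipe

variable {n : Type*} [Fintype n] [DecidableEq n]

/-! ## Compactness of the frame space `U(n) × T` and continuity of recomposition -/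

omit [Fintype n] [DecidableEq n] in
/-- **The unimodular torus `T = {d | ∀ i, ‖d i‖ = 1} ⊆ ℂⁿ` is compact** (a product of unit
circles). -/
theorem isCompact_unimodularTorus : IsCompact {d : n → ℂ | ∀ i, ‖d i‖ = 1} := by
  have h : {d : n → ℂ | ∀ i, ‖d i‖ = 1} = Set.univ.pi fun _ : n => Metric.sphere (0 : ℂ) 1 := by
    ext d
    simp only [Set.mem_setOf_eq, Set.mem_univ_pi, mem_sphere_iff_norm, sub_zero]
  rw [h]
  exact isCompact_univ_pi fun _ => isCompact_sphere (0 : ℂ) 1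

/-- **The frame space `U(n) × T` (unitary frames × unimodular eigenvalue tuples) is compact.** -/
theorem isCompact_unitaryFrames :
    IsCompact {k : Matrix n n ℂ × (n → ℂ) | k.1 ∈ Matrix.unitaryGroup n ℂ ∧ ∀ i, ‖k.2 i‖ = 1} := by
  have hU : IsCompact (Matrix.unitaryGroup n ℂ : Set (Matrix n n ℂ)) :=
    isCompact_iff_compactSpace.mpr Matrix.unitaryGroup.instCompactSpace
  have h : {k : Matrix n n ℂ × (n → ℂ) | k.1 ∈ Matrix.unitaryGroup n ℂ ∧ ∀ i, ‖k.2 i‖ = 1} =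
      (Matrix.unitaryGroup n ℂ : Set (Matrix n n ℂ)) ×ˢ {d : n → ℂ | ∀ i, ‖d i‖ = 1} := by
    ext k
    simp only [Set.mem_setOf_eq, Set.mem_prod, SetLike.mem_coe]
  rw [h]
  exact hU.prod isCompact_unimodularTorus

/-- **Recomposition `(V, e) ↦ V diag(e) V⋆` is continuous** (matrix ring operations and `star`). -/
theorem continuous_conjDiagonal :
    Continuous fun k : Matrix n n ℂ × (n → ℂ) => k.1 * diagonal k.2 * star k.1 :=
  (continuous_fst.mul (continuous_snd.matrix_diagonal)).mul continuous_fst.star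

/-! ## The mechanism: projection along the compact frame space -/

/-- **Continuity from the spectral recipe (parametric, choice-free).**  Let `X` be any
topological space, `ι : X → Matrix n n ℂ` continuous with unitary values, `F : X → (n → ℂ) →
(n → ℂ)` an `X`-indexed family of eigenvalue maps, jointly continuous on `X × T`, and
`g : X → Matrix n n ℂ` any map that follows the spectral recipe of `F x` at `ι x`:
`ι x = V diag(d) V⋆` with `V ∈ U(n)` ⟹ `g x = V diag(F x d) V⋆`.  Then `g` is continuous.

Proof.  For a closed `C`, `x ∈ g⁻¹ C` iff some frame `(V, d) ∈ U(n) × T` has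
`ι x = V diag(d) V⋆` and `V diag(F x d) V⋆ ∈ C` (every unitary `ι x` has a unitary
diagonalisation with unimodular spectrum; the recipe fixes `g x`).  So `g⁻¹ C` is the
projection to `X` of a closed subset of `X × (U(n) × T)`, and projection along a compact factor
is a closed map. -/
theorem continuous_of_spectralRecipe {X : Type*} [TopologicalSpace X]
    {ι g : X → Matrix n n ℂ} {F : X → (n → ℂ) → (n → ℂ)} (hι : Continuous ι)
    (hιU : ∀ x, ι x ∈ Matrix.unitaryGroup n ℂ)
    (hF : ContinuousOn (fun q : X × (n → ℂ) => F q.1 q.2) {q | ∀ i, ‖q.2 i‖ = 1})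
    (hagree : ∀ (x : X) (V : Matrix n n ℂ) (d : n → ℂ), V ∈ Matrix.unitaryGroup n ℂ →
      ι x = V * diagonal d * star V → g x = V * diagonal (F x d) * star V) :
    Continuous g := by
  -- the compact frame space as a type
  set K : Set (Matrix n n ℂ × (n → ℂ)) :=
    {k | k.1 ∈ Matrix.unitaryGroup n ℂ ∧ ∀ i, ‖k.2 i‖ = 1} with hK
  haveI : CompactSpace K := isCompact_iff_compactSpace.mp isCompact_unitaryFrames
  -- the recipe's output as a continuous function on `X × K`
  let Φ : X × K → Matrix n n ℂ := fun q =>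
    (q.2 : Matrix n n ℂ × (n → ℂ)).1 * diagonal (F q.1 (q.2 : Matrix n n ℂ × (n → ℂ)).2) *
      star (q.2 : Matrix n n ℂ × (n → ℂ)).1
  have hFF : Continuous fun q : X × K => F q.1 (q.2 : Matrix n n ℂ × (n → ℂ)).2 := by
    have hin : Continuous fun q : X × K => (q.1, (q.2 : Matrix n n ℂ × (n → ℂ)).2) :=
      continuous_fst.prodMk (continuous_snd.comp (continuous_subtype_val.comp continuous_snd))
    exact hF.comp_continuous hin fun q => q.2.2.2
  have hΦ : Continuous Φ :=
    (((continuous_fst.comp (continuous_subtype_val.comp continuous_snd)).mul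
      hFF.matrix_diagonal).mul
      (continuous_fst.comp (continuous_subtype_val.comp continuous_snd)).star)
  -- the diagonalisation relation, a closed subset of `X × K`
  let E : Set (X × K) := {q | ι q.1 =
    (q.2 : Matrix n n ℂ × (n → ℂ)).1 * diagonal (q.2 : Matrix n n ℂ × (n → ℂ)).2 *
      star (q.2 : Matrix n n ℂ × (n → ℂ)).1}
  have hE : IsClosed E :=
    isClosed_eq (hι.comp continuous_fst)
      (continuous_conjDiagonal.comp (continuous_subtype_val.comp continuous_snd))
  rw [continuous_iff_isClosed]
  intro C hC
  have hset : g ⁻¹' C = Prod.fst '' (E ∩ Φ ⁻¹' C) := by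
    ext x
    constructor
    · intro hx
      obtain ⟨V, hV, d, hxd⟩ := exists_eq_conj_diagonal_of_mem_unitaryGroup (hιU x)
      have hd : ∀ i, ‖d i‖ = 1 := norm_eq_one_of_eq_conj_diagonal (hιU x) hV hxd
      refine ⟨(x, ⟨(V, d), ⟨hV, hd⟩⟩), ⟨hxd, ?_⟩, rfl⟩
      change V * diagonal (F x d) * star V ∈ C
      rw [← hagree x V d hV hxd]
      exact hx
    · rintro ⟨q, ⟨hqE, hqC⟩, rfl⟩
      change g q.1 ∈ C
      rw [hagree q.1 _ _ q.2.2.1 hqE]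
      exact hqC
  rw [hset]
  exact isClosedMap_fst_of_compactSpace _ (hE.inter (hC.preimage hΦ))

/-! ## The kernel on `U(n)` and on `SU(n)` -/

/-- **The spectral kernel on `U(n)` is continuous** whenever its eigenvalue map is continuous on
the unimodular torus: ANY `h : U(n) → U(n)` agreeing with the spectral recipe of `f` on all
unitary diagonalisations is continuous (whatever frames were chosen to build it). -/
theorem continuous_spectralKernel_unitaryGroup {f : (n → ℂ) → (n → ℂ)}
    {h : Matrix.unitaryGroup n ℂ → Matrix.unitaryGroup n ℂ}
    (hf : ContinuousOn f {d | ∀ i, ‖d i‖ = 1})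
    (hagree : ∀ (P : Matrix.unitaryGroup n ℂ) (V : Matrix n n ℂ) (d : n → ℂ),
      V ∈ Matrix.unitaryGroup n ℂ → (P : Matrix n n ℂ) = V * diagonal d * star V →
        ((h P : Matrix.unitaryGroup n ℂ) : Matrix n n ℂ) = V * diagonal (f d) * star V) :
    Continuous h := by
  rw [IsInducing.subtypeVal.continuous_iff]
  exact continuous_of_spectralRecipe (F := fun _ => f) continuous_subtype_val (fun P => P.2)
    (hf.comp continuousOn_snd fun q hq => hq) hagree

/-- **The spectral kernel on `SU(n)` is continuous** whenever its eigenvalue map is continuous on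
the unimodular torus. -/
theorem continuous_spectralKernel_specialUnitaryGroup {f : (n → ℂ) → (n → ℂ)}
    {h : Matrix.specialUnitaryGroup n ℂ → Matrix.specialUnitaryGroup n ℂ}
    (hf : ContinuousOn f {d | ∀ i, ‖d i‖ = 1})
    (hagree : ∀ (P : Matrix.specialUnitaryGroup n ℂ) (V : Matrix n n ℂ) (d : n → ℂ),
      V ∈ Matrix.unitaryGroup n ℂ → (P : Matrix n n ℂ) = V * diagonal d * star V →
        ((h P : Matrix.specialUnitaryGroup n ℂ) : Matrix n n ℂ) = V * diagonal (f d) * star V) :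
    Continuous h := by
  rw [IsInducing.subtypeVal.continuous_iff]
  exact continuous_of_spectralRecipe (F := fun _ => f) continuous_subtype_val
    (fun P => (Matrix.mem_specialUnitaryGroup_iff.mp P.2).1)
    (hf.comp continuousOn_snd fun q hq => hq) hagree

/-- **Joint continuity in (parameters, loop) on `U(n)`.**  If the eigenvalue maps `f y` depend on
parameters `y ∈ Y` (the conditioner's outputs, read from the frozen context) jointly continuously
on `Y × T`, and each `h y` agrees with the recipe of `f y`, then `(y, P) ↦ h y P` is jointly
continuous — the shape needed for the layer as a map of the whole configuration. -/
theorem continuous_spectralKernel_unitaryGroup_param {Y : Type*} [TopologicalSpace Y]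
    {f : Y → (n → ℂ) → (n → ℂ)} {h : Y → Matrix.unitaryGroup n ℂ → Matrix.unitaryGroup n ℂ}
    (hf : ContinuousOn (fun q : Y × (n → ℂ) => f q.1 q.2) {q | ∀ i, ‖q.2 i‖ = 1})
    (hagree : ∀ (y : Y) (P : Matrix.unitaryGroup n ℂ) (V : Matrix n n ℂ) (d : n → ℂ),
      V ∈ Matrix.unitaryGroup n ℂ → (P : Matrix n n ℂ) = V * diagonal d * star V →
        ((h y P : Matrix.unitaryGroup n ℂ) : Matrix n n ℂ) = V * diagonal (f y d) * star V) :
    Continuous fun q : Y × Matrix.unitaryGroup n ℂ => h q.1 q.2 := by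
  rw [IsInducing.subtypeVal.continuous_iff]
  refine continuous_of_spectralRecipe (X := Y × Matrix.unitaryGroup n ℂ)
    (ι := fun q => (q.2 : Matrix n n ℂ)) (F := fun q => f q.1)
    (continuous_subtype_val.comp continuous_snd) (fun q => q.2.2) ?_ fun q V d hV hq =>
      hagree q.1 q.2 V d hV hq
  have hin : Continuous fun q : (Y × Matrix.unitaryGroup n ℂ) × (n → ℂ) => (q.1.1, q.2) :=
    (continuous_fst.comp continuous_fst).prodMk continuous_snd
  exact hf.comp hin.continuousOn fun q hq => hq

/-- **Joint continuity in (parameters, loop) on `SU(n)`.** -/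
theorem continuous_spectralKernel_specialUnitaryGroup_param {Y : Type*} [TopologicalSpace Y]
    {f : Y → (n → ℂ) → (n → ℂ)}
    {h : Y → Matrix.specialUnitaryGroup n ℂ → Matrix.specialUnitaryGroup n ℂ}
    (hf : ContinuousOn (fun q : Y × (n → ℂ) => f q.1 q.2) {q | ∀ i, ‖q.2 i‖ = 1})
    (hagree : ∀ (y : Y) (P : Matrix.specialUnitaryGroup n ℂ) (V : Matrix n n ℂ) (d : n → ℂ),
      V ∈ Matrix.unitaryGroup n ℂ → (P : Matrix n n ℂ) = V * diagonal d * star V →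
        ((h y P : Matrix.specialUnitaryGroup n ℂ) : Matrix n n ℂ) =
          V * diagonal (f y d) * star V) :
    Continuous fun q : Y × Matrix.specialUnitaryGroup n ℂ => h q.1 q.2 := by
  rw [IsInducing.subtypeVal.continuous_iff]
  refine continuous_of_spectralRecipe (X := Y × Matrix.specialUnitaryGroup n ℂ)
    (ι := fun q => (q.2 : Matrix n n ℂ)) (F := fun q => f q.1)
    (continuous_subtype_val.comp continuous_snd)
    (fun q => (Matrix.mem_specialUnitaryGroup_iff.mp q.2.2).1) ?_ fun q V d hV hq =>
      hagree q.1 q.2 V d hV hq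
  have hin : Continuous fun q : (Y × Matrix.specialUnitaryGroup n ℂ) × (n → ℂ) => (q.1.1, q.2) :=
    (continuous_fst.comp continuous_fst).prodMk continuous_snd
  exact hf.comp hin.continuousOn fun q hq => hq

/-! ## The converse: a continuous kernel has a continuous eigenvalue map on the torus -/

/-- **On the torus the kernel IS the eigenvalue map**: `h (diag d) = diag (f d)` for unimodular
`d` (the recipe with the frame `V = 1`). -/
theorem spectralKernel_unitaryGroup_apply_diagonal {f : (n → ℂ) → (n → ℂ)}
    {h : Matrix.unitaryGroup n ℂ → Matrix.unitaryGroup n ℂ}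
    (hagree : ∀ (P : Matrix.unitaryGroup n ℂ) (V : Matrix n n ℂ) (d : n → ℂ),
      V ∈ Matrix.unitaryGroup n ℂ → (P : Matrix n n ℂ) = V * diagonal d * star V →
        ((h P : Matrix.unitaryGroup n ℂ) : Matrix n n ℂ) = V * diagonal (f d) * star V)
    {d : n → ℂ} (hd : ∀ i, ‖d i‖ = 1) :
    ((h ⟨diagonal d, (diagonal_mem_unitaryGroup_iff d).mpr hd⟩ : Matrix.unitaryGroup n ℂ) :
      Matrix n n ℂ) = diagonal (f d) := by
  have key := hagree ⟨diagonal d, (diagonal_mem_unitaryGroup_iff d).mpr hd⟩ 1 d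
    (Submonoid.one_mem _) (by rw [star_one, Matrix.one_mul, Matrix.mul_one])
  rw [key, star_one, Matrix.one_mul, Matrix.mul_one]

/-- **Converse: a continuous kernel has an eigenvalue map continuous on the torus.**  If
`h : U(n) → U(n)` is continuous and agrees with the recipe of `f`, then `f` is continuous on `T`:
there `f d` is the diagonal of `h (diag d)`. -/
theorem continuousOn_eigenvalueMap_of_continuous {f : (n → ℂ) → (n → ℂ)}
    {h : Matrix.unitaryGroup n ℂ → Matrix.unitaryGroup n ℂ} (hh : Continuous h)
    (hagree : ∀ (P : Matrix.unitaryGroup n ℂ) (V : Matrix n n ℂ) (d : n → ℂ),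
      V ∈ Matrix.unitaryGroup n ℂ → (P : Matrix n n ℂ) = V * diagonal d * star V →
        ((h P : Matrix.unitaryGroup n ℂ) : Matrix n n ℂ) = V * diagonal (f d) * star V) :
    ContinuousOn f {d | ∀ i, ‖d i‖ = 1} := by
  rw [continuousOn_iff_continuous_restrict]
  -- the torus embeds continuously into `U(n)` as diagonal matrices
  have hemb : Continuous fun t : {d : n → ℂ | ∀ i, ‖d i‖ = 1} =>
      (⟨diagonal (t : n → ℂ), (diagonal_mem_unitaryGroup_iff (t : n → ℂ)).mpr t.2⟩ :
        Matrix.unitaryGroup n ℂ) :=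
    (continuous_subtype_val.matrix_diagonal).subtype_mk _
  have hdiag : Continuous fun M : Matrix n n ℂ => fun i => M i i :=
    continuous_pi fun i => (continuous_apply i).comp (continuous_apply i)
  have heq : ({d : n → ℂ | ∀ i, ‖d i‖ = 1}).restrict f =
      fun t : {d : n → ℂ | ∀ i, ‖d i‖ = 1} => (fun M : Matrix n n ℂ => fun i => M i i)
        (((h ⟨diagonal (t : n → ℂ), (diagonal_mem_unitaryGroup_iff (t : n → ℂ)).mpr t.2⟩ :
          Matrix.unitaryGroup n ℂ) : Matrix n n ℂ)) := by
    funext t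
    rw [spectralKernel_unitaryGroup_apply_diagonal hagree t.2]
    funext i
    simp only [Set.restrict_apply, diagonal_apply_eq]
  rw [heq]
  exact hdiag.comp (continuous_subtype_val.comp (hh.comp hemb))

/-- **The kernel is continuous iff the eigenvalue map is continuous on the torus** (`U(n)`). -/
theorem continuous_spectralKernel_unitaryGroup_iff {f : (n → ℂ) → (n → ℂ)}
    {h : Matrix.unitaryGroup n ℂ → Matrix.unitaryGroup n ℂ}
    (hagree : ∀ (P : Matrix.unitaryGroup n ℂ) (V : Matrix n n ℂ) (d : n → ℂ),
      V ∈ Matrix.unitaryGroup n ℂ → (P : Matrix n n ℂ) = V * diagonal d * star V →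
        ((h P : Matrix.unitaryGroup n ℂ) : Matrix n n ℂ) = V * diagonal (f d) * star V) :
    Continuous h ↔ ContinuousOn f {d | ∀ i, ‖d i‖ = 1} :=
  ⟨fun hh => continuousOn_eigenvalueMap_of_continuous hh hagree,
    fun hf => continuous_spectralKernel_unitaryGroup hf hagree⟩

/-! ## Corollaries: Borel measurability, uniform continuity, existence of continuous kernels -/

/-- **The spectral kernel on `U(n)` is Borel measurable** (for the Borel structure of the tree's
`GaugeGroups.lean`) — the measurability hypothesis of every pushforward / `HasJacobian` statement
about the layer. -/
theorem measurable_spectralKernel_unitaryGroup {f : (n → ℂ) → (n → ℂ)}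
    {h : Matrix.unitaryGroup n ℂ → Matrix.unitaryGroup n ℂ}
    (hf : ContinuousOn f {d | ∀ i, ‖d i‖ = 1})
    (hagree : ∀ (P : Matrix.unitaryGroup n ℂ) (V : Matrix n n ℂ) (d : n → ℂ),
      V ∈ Matrix.unitaryGroup n ℂ → (P : Matrix n n ℂ) = V * diagonal d * star V →
        ((h P : Matrix.unitaryGroup n ℂ) : Matrix n n ℂ) = V * diagonal (f d) * star V) :
    Measurable h :=
  (continuous_spectralKernel_unitaryGroup hf hagree).measurable

/-- **The spectral kernel on `SU(n)` is Borel measurable.** -/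
theorem measurable_spectralKernel_specialUnitaryGroup {f : (n → ℂ) → (n → ℂ)}
    {h : Matrix.specialUnitaryGroup n ℂ → Matrix.specialUnitaryGroup n ℂ}
    (hf : ContinuousOn f {d | ∀ i, ‖d i‖ = 1})
    (hagree : ∀ (P : Matrix.specialUnitaryGroup n ℂ) (V : Matrix n n ℂ) (d : n → ℂ),
      V ∈ Matrix.unitaryGroup n ℂ → (P : Matrix n n ℂ) = V * diagonal d * star V →
        ((h P : Matrix.specialUnitaryGroup n ℂ) : Matrix n n ℂ) = V * diagonal (f d) * star V) :
    Measurable h :=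
  (continuous_spectralKernel_specialUnitaryGroup hf hagree).measurable

/-- **The spectral kernel on `U(n)` is uniformly continuous** (continuous on a compact group). -/
theorem uniformContinuous_spectralKernel_unitaryGroup {f : (n → ℂ) → (n → ℂ)}
    {h : Matrix.unitaryGroup n ℂ → Matrix.unitaryGroup n ℂ}
    (hf : ContinuousOn f {d | ∀ i, ‖d i‖ = 1})
    (hagree : ∀ (P : Matrix.unitaryGroup n ℂ) (V : Matrix n n ℂ) (d : n → ℂ),
      V ∈ Matrix.unitaryGroup n ℂ → (P : Matrix n n ℂ) = V * diagonal d * star V →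
        ((h P : Matrix.unitaryGroup n ℂ) : Matrix n n ℂ) = V * diagonal (f d) * star V) :
    UniformContinuous h :=
  CompactSpace.uniformContinuous_of_continuous (continuous_spectralKernel_unitaryGroup hf hagree)

/-- **A continuous kernel exists on `U(n)`** for every permutation-equivariant eigenvalue map
that is continuous on the torus and preserves unimodularity: there is a CONTINUOUS
`h : U(n) → U(n)` with `h P = V diag(f d) V⋆` on every unitary diagonalisation, hence
(`SpectralKernelMap.spectralKernel_unitaryGroup_conj`) conjugation equivariant. -/
theorem exists_continuous_spectralKernel_unitaryGroup {f : (n → ℂ) → (n → ℂ)}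
    (hf : ∀ (σ : Equiv.Perm n) (d : n → ℂ), f (fun k => d (σ k)) = fun k => f d (σ k))
    (hf1 : ∀ d : n → ℂ, (∀ i, ‖d i‖ = 1) → ∀ i, ‖f d i‖ = 1)
    (hfc : ContinuousOn f {d | ∀ i, ‖d i‖ = 1}) :
    ∃ h : Matrix.unitaryGroup n ℂ → Matrix.unitaryGroup n ℂ, Continuous h ∧
      (∀ X P : Matrix.unitaryGroup n ℂ, h (X * P * X⁻¹) = X * h P * X⁻¹) ∧
      ∀ (P : Matrix.unitaryGroup n ℂ) (V : Matrix n n ℂ) (d : n → ℂ), V ∈ Matrix.unitaryGroup n ℂ →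
        (P : Matrix n n ℂ) = V * diagonal d * star V →
          ((h P : Matrix.unitaryGroup n ℂ) : Matrix n n ℂ) = V * diagonal (f d) * star V := by
  obtain ⟨h, hagree⟩ := exists_spectralKernel_unitaryGroup hf hf1
  exact ⟨h, continuous_spectralKernel_unitaryGroup hfc hagree,
    spectralKernel_unitaryGroup_conj hagree, hagree⟩

/-- **A continuous kernel exists on `SU(n)`** for every permutation-equivariant eigenvalue map
that is continuous on the torus and preserves unimodularity and `∏ λ_i = 1`. -/
theorem exists_continuous_spectralKernel_specialUnitaryGroup {f : (n → ℂ) → (n → ℂ)}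
    (hf : ∀ (σ : Equiv.Perm n) (d : n → ℂ), f (fun k => d (σ k)) = fun k => f d (σ k))
    (hf1 : ∀ d : n → ℂ, (∀ i, ‖d i‖ = 1) → ∀ i, ‖f d i‖ = 1)
    (hfdet : ∀ d : n → ℂ, (∀ i, ‖d i‖ = 1) → ∏ i, d i = 1 → ∏ i, f d i = 1)
    (hfc : ContinuousOn f {d | ∀ i, ‖d i‖ = 1}) :
    ∃ h : Matrix.specialUnitaryGroup n ℂ → Matrix.specialUnitaryGroup n ℂ, Continuous h ∧
      (∀ X P : Matrix.specialUnitaryGroup n ℂ, h (X * P * X⁻¹) = X * h P * X⁻¹) ∧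
      ∀ (P : Matrix.specialUnitaryGroup n ℂ) (V : Matrix n n ℂ) (d : n → ℂ),
        V ∈ Matrix.unitaryGroup n ℂ → (P : Matrix n n ℂ) = V * diagonal d * star V →
          ((h P : Matrix.specialUnitaryGroup n ℂ) : Matrix n n ℂ) = V * diagonal (f d) * star V := by
  obtain ⟨h, hagree⟩ := exists_spectralKernel_specialUnitaryGroup hf hf1 hfdet
  exact ⟨h, continuous_spectralKernel_specialUnitaryGroup hfc hagree,
    spectralKernel_specialUnitaryGroup_conj hagree, hagree⟩

end Recipe

end Summit.Ventures.LatticeQCDFlow.Exactness
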